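import Summits.Ventures.GridStability.Lyapunov.StructurePreservingRateRoa
import HarnessLib

/-!
# GridStability/Lyapunov/StructurePreservingRatePoincare — «SP-RATE» RECEPTACLE: the exponential rate from
# ANY certified leaf-Poincaré pair `(A, B)` with `Σ Dᵢφᵢ² ≤ A·Q + B·K` on the region (closed form `n²`,
# diameter `d`, or a kernel spectral certificate), rate `ρ` with `ρ(2 + hB) ≤ 2h`, `ρ(1 + hA) ≤ 2h·g(θ)`

Cell `gridfusion` (LADDER-GRIDFUSION), seat gridfusion-lyap-1 (g7), brief «SP-RATE». The two closed-form
files (`StructurePreservingRate.lean` p544339: `A = 4n²ΣD/β`, `B = 2Σ_gen M/ΣD`; `StructurePreservingRateDiam`: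
`A = 4d·ΣD/β`) differ ONLY in the leaf-Poincaré constant. This file factors the argument through an
ABSTRACT Poincaré pair `(A, B)` supplied as a hypothesis on the region, and an abstract rate `ρ ≥ 0` / gain
`C` satisfying the two scalar inequalities each — so that the next lever (a SPECTRAL constant: `A` from a
kernel PSD certificate on the D-weighted coupling Laplacian restricted to the momentum leaf, per object) plugs
in with no new analysis. No definition, no named fact; standard axioms.

WHAT IS PROVED (MODEL MV-3, any `n` / graph / damping; `0 < h`, `2hMᵢ ≤ Dᵢ` on the generators):
* `fderiv_vh_le_neg_mul_of_poincare` — at a phase point `x` of the closed window with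
  `Σ Dᵢφᵢ² ≤ A·Q(x) + B·K(x)`: `DV_h(x)·F(x) ≤ −ρ·V_h(x)` whenever `0 ≤ ρ`, `ρ(2 + hB) ≤ 2h`,
  `ρ(1 + hA) ≤ 2h·g(θ)`;
* `vh_le_mul_phaseEnergy_of_poincare` — `V_h ≤ C·V` whenever `2 + hB ≤ C` and `1 + hA ≤ C·g(θ)`;
* **`phaseEnergy_le_mul_exp_neg_of_poincare`** — if the Poincaré pair holds on the closed window ∩ leaf,
  then along EVERY global solution from `S = {V ≤ c < c⋆(θ, β)} ∩ window ∩ leaf`, for all `t ≥ 0`: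
  `V(X t) ≤ 3C·V(X 0)·e^{−ρt}`.
THREE COLUMNS: mathematics about MODEL MV-3; `ρ` is a certified LOWER bound on the model's rate given the
certified pair `(A, B)`; no sentence here says a grid is stable or well damped. [cite: Khalil2002, Theorem 4.10]
-/

noncomputable section

open Set Filter Topology Real Finset
open Summit.Ventures.GridStability.Models.StructurePreserving
open Summit.Ventures.GridStability.Models.StructurePreserving.Params
open Literature.MathematicalPhysics.PowerSystems (SinusoidalCoupling.sectorGain_pos)

namespace Summit.Ventures.GridStability.Lyapunov.StructurePreserving

variable {n : ℕ}

/-- **Pointwise rate from an abstract Poincaré pair.** Well-formed data, susceptive couplings, equilibrium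
line angles `|σ*| ≤ θ < π/2`, a synchronous equilibrium `δ₀`, `0 < h` with `2hMᵢ ≤ Dᵢ` on the generators;
at a phase point `x` with every coupled line angle in the closed window and the leaf-Poincaré inequality
`Σ Dᵢφᵢ² ≤ A·Q + B·K` (any real `A, B`), every `ρ ≥ 0` with `ρ(2 + hB) ≤ 2h` and `ρ(1 + hA) ≤ 2h·g(θ)` gives
`DV_h(x)·F(x) ≤ −ρ·V_h(x)`. [cite: Khalil2002, Theorem 4.10 (hypothesis (4.26))] -/
theorem fderiv_vh_le_neg_mul_of_poincare {p : Params n} (hp : p.WellFormed) (hb : ∀ i j, 0 ≤ p.b i j)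
    {δ₀ : Fin n → ℝ} {θ : ℝ} (hθ : θ < π / 2)
    (h0 : ∀ i j, p.b i j ≠ 0 → |δ₀ i - δ₀ j| ≤ θ) (hδ₀ : p.IsSyncEquilibrium δ₀)
    {h : ℝ} (hh : 0 < h) (hhM : ∀ i ∈ p.gen, 2 * h * p.M i ≤ p.D i)
    {x : (Fin n → ℝ) × (Fin n → ℝ)} (hP : ∀ i j, p.b i j ≠ 0 → |x.1 i - x.1 j| ≤ π / 2)
    {A B : ℝ}
    (hPoinc : ∑ i, p.D i * (x.1 i - δ₀ i) ^ 2
      ≤ A * ((1 / 2) * ∑ i, ∑ j, p.b i j * (((x.1 i - x.1 j) - (δ₀ i - δ₀ j)) ^ 2 / 2))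
        + B * p.kinetic x.2)
    {ρ : ℝ} (hρ0 : 0 ≤ ρ) (hρK : ρ * (2 + h * B) ≤ 2 * h)
    (hρQ : ρ * (1 + h * A) ≤ 2 * h * ((1 - Real.sin θ) / (π / 2 - θ))) :
    fderiv ℝ (fun y => phaseEnergy p δ₀ y + h * crossTerm p δ₀ y) x (phaseField p x)
      ≤ -ρ * (phaseEnergy p δ₀ x + h * crossTerm p δ₀ x) := by
  set gθ := (1 - Real.sin θ) / (π / 2 - θ) with hgθ
  set K : ℝ := p.kinetic x.2 with hK
  set Qx : ℝ := (1 / 2) * ∑ i, ∑ j, p.b i j * (((x.1 i - x.1 j) - (δ₀ i - δ₀ j)) ^ 2 / 2)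
    with hQx
  set Φ : ℝ := ∑ i, p.D i * (x.1 i - δ₀ i) ^ 2 with hΦ
  have hK0 : 0 ≤ K := p.kinetic_nonneg (fun i hi => (hp.M_pos i hi).le) x.2
  have hQ0 : 0 ≤ Qx := p.quadraticGap_nonneg hb δ₀ x.1
  -- dissipation
  have hdiss : fderiv ℝ (fun y => phaseEnergy p δ₀ y + h * crossTerm p δ₀ y) x (phaseField p x)
      ≤ -(2 * h * K) - 2 * h * gθ * Qx := by
    rw [fderiv_vh_phaseField hp hδ₀ h x, vh_rate_eq x δ₀ h]
    have h1 : 0 ≤ ∑ i ∈ univ \ p.gen, p.D i * (phaseField p x).1 i ^ 2 :=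
      Finset.sum_nonneg fun i _ => mul_nonneg (hp.D_pos i).le (sq_nonneg _)
    have h2 : 2 * h * K ≤ ∑ i ∈ p.gen, (p.D i - h * p.M i) * x.2 i ^ 2 := by
      have hK2 : 2 * h * K = ∑ i ∈ p.gen, h * p.M i * x.2 i ^ 2 := by
        rw [hK]; unfold Params.kinetic
        rw [Finset.mul_sum, Finset.mul_sum]
        exact Finset.sum_congr rfl fun i _ => by ring
      rw [hK2]
      refine Finset.sum_le_sum fun i hi => mul_le_mul_of_nonneg_right ?_ (sq_nonneg _)
      linarith [hhM i hi]
    have h3 : 2 * gθ * Qx ≤ pairing p δ₀ x.1 := pairing_ge_quadratic p hb hθ h0 hP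
    nlinarith
  -- upper bound through the abstract pair
  have hup : phaseEnergy p δ₀ x + h * crossTerm p δ₀ x ≤ (2 + h * B) * K + (1 + h * A) * Qx := by
    have hAx := vh_le_of_two_mul_le hp hb δ₀ hh.le hhM x
    rw [← hK, ← hΦ, ← hQx] at hAx
    have hB' := mul_le_mul_of_nonneg_left hPoinc hh.le
    have : h * (A * Qx + B * K) = (h * B) * K + (h * A) * Qx := by ring
    rw [this] at hB'
    linarith
  have hfin : ρ * (phaseEnergy p δ₀ x + h * crossTerm p δ₀ x) ≤ 2 * h * K + 2 * h * gθ * Qx := by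
    have := mul_le_mul_of_nonneg_left hup hρ0
    have e : ρ * ((2 + h * B) * K + (1 + h * A) * Qx)
        = (ρ * (2 + h * B)) * K + (ρ * (1 + h * A)) * Qx := by ring
    rw [e] at this
    nlinarith [mul_le_mul_of_nonneg_right hρK hK0, mul_le_mul_of_nonneg_right hρQ hQ0]
  linarith

/-- **Gain from an abstract Poincaré pair**: at a phase point of the closed window with
`Σ Dᵢφᵢ² ≤ A·Q + B·K` (`B ≥ 0`), every `C` with `2 + hB ≤ C` and `1 + hA ≤ C·g(θ)` gives `V_h ≤ C·V`
(`0 ≤ h`, `2hMᵢ ≤ Dᵢ` on the generators; `g(θ)·Q ≤ W`). [folklore] -/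
theorem vh_le_mul_phaseEnergy_of_poincare {p : Params n} (hp : p.WellFormed) (hb : ∀ i j, 0 ≤ p.b i j)
    {δ₀ : Fin n → ℝ} {θ : ℝ} (hθ0 : 0 ≤ θ) (hθ : θ < π / 2)
    (h0 : ∀ i j, p.b i j ≠ 0 → |δ₀ i - δ₀ j| ≤ θ)
    {h : ℝ} (hh : 0 ≤ h) (hhM : ∀ i ∈ p.gen, 2 * h * p.M i ≤ p.D i)
    {x : (Fin n → ℝ) × (Fin n → ℝ)} (hP : ∀ i j, p.b i j ≠ 0 → |x.1 i - x.1 j| ≤ π / 2)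
    {A B : ℝ}
    (hPoinc : ∑ i, p.D i * (x.1 i - δ₀ i) ^ 2
      ≤ A * ((1 / 2) * ∑ i, ∑ j, p.b i j * (((x.1 i - x.1 j) - (δ₀ i - δ₀ j)) ^ 2 / 2))
        + B * p.kinetic x.2)
    (hB0 : 0 ≤ B) {C : ℝ} (hCK : 2 + h * B ≤ C)
    (hCQ : 1 + h * A ≤ C * ((1 - Real.sin θ) / (π / 2 - θ))) :
    phaseEnergy p δ₀ x + h * crossTerm p δ₀ x ≤ C * phaseEnergy p δ₀ x := by
  set gθ := (1 - Real.sin θ) / (π / 2 - θ) with hgθ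
  set K : ℝ := p.kinetic x.2 with hK
  set Qx : ℝ := (1 / 2) * ∑ i, ∑ j, p.b i j * (((x.1 i - x.1 j) - (δ₀ i - δ₀ j)) ^ 2 / 2)
    with hQx
  set Φ : ℝ := ∑ i, p.D i * (x.1 i - δ₀ i) ^ 2 with hΦ
  have hg : 0 < gθ := SinusoidalCoupling.sectorGain_pos hθ0 hθ
  have hK0 : 0 ≤ K := p.kinetic_nonneg (fun i hi => (hp.M_pos i hi).le) x.2
  have hQ0 : 0 ≤ Qx := p.quadraticGap_nonneg hb δ₀ x.1
  have hup : phaseEnergy p δ₀ x + h * crossTerm p δ₀ x ≤ (2 + h * B) * K + (1 + h * A) * Qx := by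
    have hAx := vh_le_of_two_mul_le hp hb δ₀ hh hhM x
    rw [← hK, ← hΦ, ← hQx] at hAx
    have hB' := mul_le_mul_of_nonneg_left hPoinc hh
    have : h * (A * Qx + B * K) = (h * B) * K + (h * A) * Qx := by ring
    rw [this] at hB'
    linarith
  have hW : gθ * Qx ≤ p.potential δ₀ x.1 := p.potential_ge_quadratic hb hθ0 hθ h0 hP
  have hV : phaseEnergy p δ₀ x = K + p.potential δ₀ x.1 := rfl
  have hW0 : 0 ≤ p.potential δ₀ x.1 := le_trans (mul_nonneg hg.le hQ0) hW
  have hC0 : 0 ≤ C := by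
    have : 0 ≤ h * B := mul_nonneg hh hB0
    linarith
  -- (1 + hA)·Q ≤ C·g·Q ≤ C·W and (2 + hB)·K ≤ C·K
  have hQW : (1 + h * A) * Qx ≤ C * p.potential δ₀ x.1 :=
    calc (1 + h * A) * Qx ≤ (C * gθ) * Qx := mul_le_mul_of_nonneg_right hCQ hQ0
      _ = C * (gθ * Qx) := by ring
      _ ≤ C * p.potential δ₀ x.1 := mul_le_mul_of_nonneg_left hW hC0
  have hKC : (2 + h * B) * K ≤ C * K := mul_le_mul_of_nonneg_right hCK hK0
  rw [hV, mul_add]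
  linarith

/-- **Exponential decay of the energy of record from an abstract Poincaré pair** (the receptacle). DATA:
the region-of-record data (`c < c⋆(θ, β)`, preconnected graph, `bᵢⱼ ≥ β > 0` on edges, `|σ*| ≤ θ < π/2`),
`0 < h`, `2hMᵢ ≤ Dᵢ` on the generators; a pair `(A, B)`, `B ≥ 0`, with `Σ Dᵢφᵢ² ≤ A·Q + B·K` at every
point of the closed window on the momentum leaf; `ρ ≥ 0` with `ρ(2 + hB) ≤ 2h`, `ρ(1 + hA) ≤ 2h·g(θ)`; `C` with
`2 + hB ≤ C`, `1 + hA ≤ C·g(θ)`. CLAIM: along every global solution `X` from `S = {V ≤ c} ∩ window ∩ leaf`,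
for all `t ≥ 0`: `V(X t) ≤ 3C·V(X 0)·exp(−ρt)`. MODEL MV-3; no sentence here says a grid is stable or well
damped. [cite: Khalil2002, Theorem 4.10] -/
theorem phaseEnergy_le_mul_exp_neg_of_poincare {p : Params n} (hp : p.WellFormed) (hn : n ≠ 0)
    (hconn : p.couplingGraph.Preconnected) (hb : ∀ i j, 0 ≤ p.b i j) {β : ℝ} (hβ : 0 < β)
    (hβb : ∀ i j, p.couplingGraph.Adj i j → β ≤ p.b i j)
    {δ₀ : Fin n → ℝ} {θ : ℝ} (hθ0 : 0 ≤ θ) (hθ : θ < π / 2)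
    (h0 : ∀ i j, p.b i j ≠ 0 → |δ₀ i - δ₀ j| ≤ θ) (hδ₀ : p.IsSyncEquilibrium δ₀)
    {c : ℝ} (hc : c < levelBound θ β) {h : ℝ} (hh : 0 < h)
    (hhM : ∀ i ∈ p.gen, 2 * h * p.M i ≤ p.D i)
    {A B : ℝ}
    (hPoinc : ∀ x : (Fin n → ℝ) × (Fin n → ℝ), x ∈ constraintSet p δ₀ →
      (∀ i j, p.b i j ≠ 0 → |x.1 i - x.1 j| ≤ π / 2) →
      ∑ i, p.D i * (x.1 i - δ₀ i) ^ 2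
        ≤ A * ((1 / 2) * ∑ i, ∑ j, p.b i j * (((x.1 i - x.1 j) - (δ₀ i - δ₀ j)) ^ 2 / 2))
          + B * p.kinetic x.2)
    {ρ : ℝ} (hρ0 : 0 ≤ ρ) (hρK : ρ * (2 + h * B) ≤ 2 * h)
    (hρQ : ρ * (1 + h * A) ≤ 2 * h * ((1 - Real.sin θ) / (π / 2 - θ)))
    (hB0 : 0 ≤ B) {C : ℝ} (hCK : 2 + h * B ≤ C)
    (hCQ : 1 + h * A ≤ C * ((1 - Real.sin θ) / (π / 2 - θ)))
    {X : ℝ → (Fin n → ℝ) × (Fin n → ℝ)}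
    (hX0 : X 0 ∈ window p ∩ constraintSet p δ₀ ∧ phaseEnergy p δ₀ (X 0) ≤ c)
    (hX : ∀ T : ℝ, ∀ t ∈ Icc 0 T, HasDerivWithinAt X (phaseField p (X t)) (Icc 0 T) t)
    {t : ℝ} (ht : 0 ≤ t) :
    phaseEnergy p δ₀ (X t) ≤ 3 * C * phaseEnergy p δ₀ (X 0) * Real.exp (-ρ * t) := by
  obtain ⟨-, hall⟩ := sublevel_subset_regionOfAttraction hp hn hconn hb hβ hβb hθ0 hθ h0 hδ₀ hc hX0
  obtain ⟨hstay, -⟩ := hall X rfl hX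
  -- V_h decays at rate ρ
  have hcd : ContDiff ℝ 1 (fun y : (Fin n → ℝ) × (Fin n → ℝ) =>
      phaseEnergy p δ₀ y + h * crossTerm p δ₀ y) :=
    (contDiff_phaseEnergy p δ₀).add (contDiff_const.mul (contDiff_crossTerm p δ₀))
  have hVd : ∀ s ∈ Icc 0 t, HasFDerivAt (fun y : (Fin n → ℝ) × (Fin n → ℝ) =>
      phaseEnergy p δ₀ y + h * crossTerm p δ₀ y)
      (fderiv ℝ (fun y : (Fin n → ℝ) × (Fin n → ℝ) => phaseEnergy p δ₀ y + h * crossTerm p δ₀ y)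
        (X s)) (X s) :=
    fun s _ => ((hcd.differentiable one_ne_zero) (X s)).hasFDerivAt
  have hle : ∀ s ∈ Icc 0 t,
      fderiv ℝ (fun y : (Fin n → ℝ) × (Fin n → ℝ) => phaseEnergy p δ₀ y + h * crossTerm p δ₀ y)
          (X s) (phaseField p (X s))
        ≤ -ρ * (phaseEnergy p δ₀ (X s) + h * crossTerm p δ₀ (X s)) := by
    intro s hs
    have hmem := hstay s hs.1
    have hP : ∀ i j, p.b i j ≠ 0 → |(X s).1 i - (X s).1 j| ≤ π / 2 :=
      fun i j hij => (hmem.1.1 i j hij).le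
    exact fderiv_vh_le_neg_mul_of_poincare hp hb hθ h0 hδ₀ hh hhM hP (hPoinc (X s) hmem.1.2 hP)
      hρ0 hρK hρQ
  have hdec := Literature.Analysis.ODE.comp_le_mul_exp_neg_of_solution₀ (hX t) hVd hle ⟨ht, le_rfl⟩
  -- V ≤ 3 V_h at X t, V_h ≤ C V at X 0
  have h0' : ∀ i j, p.b i j ≠ 0 → |δ₀ i - δ₀ j| ≤ π / 2 := fun i j hij => (h0 i j hij).trans hθ.le
  have hmem := hstay t ht
  have hPt : ∀ i j, p.b i j ≠ 0 → |((X t).1 i - (X t).1 j) + (δ₀ i - δ₀ j)| ≤ π := by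
    intro i j hij
    have h1 := abs_lt.1 (hmem.1.1 i j hij)
    have h2 := abs_le.1 (h0' i j hij)
    exact abs_le.2 ⟨by linarith [h1.1, h2.1], by linarith [h1.2, h2.2]⟩
  have h3 := phaseEnergy_le_three_mul_vh hp hb h0' hh.le hhM hPt
  have hP0 : ∀ i j, p.b i j ≠ 0 → |(X 0).1 i - (X 0).1 j| ≤ π / 2 :=
    fun i j hij => (hX0.1.1 i j hij).le
  have hgain := vh_le_mul_phaseEnergy_of_poincare hp hb hθ0 hθ h0 hh.le hhM hP0
    (hPoinc (X 0) hX0.1.2 hP0) hB0 hCK hCQ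
  have hexp : 0 ≤ Real.exp (-ρ * t) := (Real.exp_pos _).le
  calc phaseEnergy p δ₀ (X t)
      ≤ 3 * (phaseEnergy p δ₀ (X t) + h * crossTerm p δ₀ (X t)) := h3
    _ ≤ 3 * ((phaseEnergy p δ₀ (X 0) + h * crossTerm p δ₀ (X 0)) * Real.exp (-ρ * t)) := by linarith
    _ ≤ 3 * ((C * phaseEnergy p δ₀ (X 0)) * Real.exp (-ρ * t)) := by
        have := mul_le_mul_of_nonneg_right hgain hexp
        linarith
    _ = 3 * C * phaseEnergy p δ₀ (X 0) * Real.exp (-ρ * t) := by ring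

end Summit.Ventures.GridStability.Lyapunov.StructurePreserving

end
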